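import Mathlib
import HarnessLib
import Summits.Ventures.LatticeQCDFlow.Exactness.U1SplinePlaquetteCouplingLayer
import Summits.Ventures.LatticeQCDFlow.Exactness.DegreeOneLayerEquiv

/-!
# The `U(1)` circular-spline plaquette coupling layer is a measurable AUTOMORPHISM of the gauge-field space, exact with the booked density: the hypotheses of flow sampling (`map_withDensity_equiv`) and of FT-HMC

HONEST FRAMING: exact (Metropolis-corrected) sampling algorithms for lattice gauge theory;
figures of merit are autocorrelation/cost numbers at stated couplings and volumes; no
continuum-physics claim.

Venture `LatticeQCDFlow` (cell pub-lqcd), topic `Exactness`; FANOUT row 10 (`eng-equiv`, engine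
`latflow.equiv` `equiv/u1.py` + `equiv/splines.py`: the spline plaquette coupling is INVERTIBLE —
`rqs_inverse` is the exact bin-by-bin inverse — and the flow sampler evaluates the model density
`q = (r/J) ∘ F⁻¹`).  NEW WORK of the cell over `U1SplinePlaquetteCouplingLayer.lean` (the layer is
exact: `HasJacobian (⊗ Haar) layer (ofReal ∘ coupleJac)`), row 14's `DegreeOneLayerEquiv`
(`exists_coupleEquiv_of_hasDerivAt_pos`: `C¹` degree-one lifts with positive derivative give
single-link measurable equivalences with jointly measurable inverse), `CircularSplineJacobian`
(the lift `Φ(t) = 2π(g(fract((t+c)/2π)) + ⌊(t+c)/2π⌋) + c'` of a unit profile: derivative, degree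
one), `CircularRQSJacobian` (the profile's calculus on `[0,1]`), row 31's `Theory2.coupleEquiv` and
`KernelCouplingMask.plaquetteKernelLayer_eq_coupleFun`.  Nothing is cited as a fact; no number; no
definition.

* **`exists_measurableEquiv_u1SplinePlaquetteCouplingLayer`** — under the hypotheses of
  `hasJacobian_u1SplinePlaquetteCouplingLayer` there is `Ψ : GaugeConfig d L Circle ≃ᵐ GaugeConfig d L Circle`
  whose forward map IS the spline plaquette coupling layer and which has
  `HasJacobian (⊗ Haar_{U(1)}) Ψ (ofReal ∘ coupleJac p j)` — so `FlowPushforward.HasJacobian.map_withDensity_equiv`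
  (the sampler's model density) and the cell's FT-HMC theorems apply to the engine's `U(1)` flow
  layers with every hypothesis discharged except the measurability of the conditioner.
-/

noncomputable section

namespace Summit.Ventures.LatticeQCDFlow.Exactness

open Real Set Function MeasureTheory Summit.Ventures.LatticeQCDFlow.Theory2
open Literature.MathematicalPhysics.QuantumFieldTheory
open scoped ENNReal

section Equiv

variable {d L : ℕ} [NeZero L]
  (p : Edge d L → Prop) [DecidablePred p] (ν : Edge d L → Fin d)
  (h1 : ∀ e, p e → ¬p (e.1.shift e.2, ν e)) (h2 : ∀ e, p e → ¬p (e.1.shift (ν e), e.2))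
  (h3 : ∀ e, p e → ¬p (e.1, ν e))
  {K : ℕ}
  {w hgt dsl X Y : Edge d L → ({f : Edge d L // ¬p f} → Circle) → ℕ → ℝ}
  (hw : ∀ e y, ∀ k < K, 0 < w e y k) (hh : ∀ e y, ∀ k < K, 0 < hgt e y k)
  (hd : ∀ e y, ∀ k ≤ K, 0 < dsl e y k) (hcirc : ∀ e y, dsl e y K = dsl e y 0)
  (hX0 : ∀ e y, X e y 0 = 0) (hXs : ∀ e y, ∀ k < K, X e y (k + 1) = X e y k + w e y k)
  (hXK : ∀ e y, X e y K = 1)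
  (hY0 : ∀ e y, Y e y 0 = 0) (hYs : ∀ e y, ∀ k < K, Y e y (k + 1) = Y e y k + hgt e y k)
  (hYK : ∀ e y, Y e y K = 1)
  {c c' : Edge d L → ({f : Edge d L // ¬p f} → Circle) → ℝ}
  (hc : ∀ e, Measurable (c e)) (hc' : ∀ e, Measurable (c' e))
  {g g' : Edge d L → ({f : Edge d L // ¬p f} → Circle) → ℝ → ℝ}
  (hgm : ∀ e, Measurable fun q : ({f : Edge d L // ¬p f} → Circle) × ℝ => g e q.1 q.2)
  (hg'm : ∀ e, Measurable fun q : ({f : Edge d L // ¬p f} → Circle) × ℝ => g' e q.1 q.2)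
  (hg : ∀ e y, ∀ k < K, ∀ x ∈ Icc (X e y k) (X e y (k + 1)), g e y x = Y e y k + hgt e y k *
      ((hgt e y k / w e y k * ((x - X e y k) / w e y k) ^ 2
      + dsl e y k * ((x - X e y k) / w e y k * (1 - (x - X e y k) / w e y k))) /
      (hgt e y k / w e y k + (dsl e y (k + 1) + dsl e y k - 2 * (hgt e y k / w e y k)) *
        ((x - X e y k) / w e y k * (1 - (x - X e y k) / w e y k)))))
  (hg' : ∀ e y, ∀ k < K, ∀ x ∈ Icc (X e y k) (X e y (k + 1)), g' e y x = hgt e y k / w e y k *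
      (hgt e y k / w e y k *
      (dsl e y (k + 1) * ((x - X e y k) / w e y k) ^ 2 + 2 * (hgt e y k / w e y k) *
        ((x - X e y k) / w e y k * (1 - (x - X e y k) / w e y k))
      + dsl e y k * (1 - (x - X e y k) / w e y k) ^ 2) /
      (hgt e y k / w e y k + (dsl e y (k + 1) + dsl e y k - 2 * (hgt e y k / w e y k)) *
        ((x - X e y k) / w e y k * (1 - (x - X e y k) / w e y k))) ^ 2))
  (hol : GaugeConfig d L Circle → Edge d L → Circle → Circle)
  (H : Edge d L → ({f : Edge d L // ¬p f} → Circle) → Circle → Circle)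
  (hHV : ∀ (V : GaugeConfig d L Circle) (e : Edge d L), p e → hol V e = H e (fun f => V f))
  (hH : ∀ e y (θ : ℝ), H e y (Circle.exp θ) =
    Circle.exp (2 * π * g e y (Int.fract ((θ + c e y) / (2 * π))) + c' e y))
  (j : Edge d L → ({f : Edge d L // ¬p f} → Circle) → Circle → ℝ)
  (hj : ∀ e y (θ : ℝ), j e y (Circle.exp θ) = g' e y (Int.fract ((θ + c e y) / (2 * π))))

include hw hh hd hcirc hX0 hXs hXK hY0 hYs hYK hc hc' hgm hg'm hg hg' hHV hH hj in
/-- **The engine's `U(1)` circular-spline plaquette coupling layer is a measurable automorphism of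
`GaugeConfig d L Circle`, exact with the booked density.**  Under the hypotheses of
`hasJacobian_u1SplinePlaquetteCouplingLayer`: there is `Ψ : GaugeConfig d L Circle ≃ᵐ GaugeConfig d L Circle`
with `⇑Ψ =` the layer (`V e ↦ hol V e (P) P⁻¹ V e` on active links, identity on frozen ones) and
`HasJacobian (⊗ haarProbability Circle) Ψ (ofReal ∘ coupleJac p (j at the plaquettes))`.  The
inverse is the coupling layer of the inverse spline kernels (`(Ψ⁻¹ V) e = h⁻¹(P̃) … ` — never
evaluated by the sampler, but it exists measurably, which is what exactness of the reported chain
needs). -/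
theorem exists_measurableEquiv_u1SplinePlaquetteCouplingLayer (hK : 0 < K) :
    ∃ Ψ : GaugeConfig d L Circle ≃ᵐ GaugeConfig d L Circle,
      (⇑Ψ = fun (V : GaugeConfig d L Circle) (e : Edge d L) =>
        if p e then hol V e (plaquetteHolonomy V e.1 e.2 (ν e)) *
          (plaquetteHolonomy V e.1 e.2 (ν e))⁻¹ * V e
        else V e) ∧
      HasJacobian (MeasureTheory.Measure.pi fun _ : Edge d L => haarProbability Circle) Ψ
        fun V => ENNReal.ofReal (Theory2.coupleJac p (fun a y u =>
          j a.1 y (u * (y ⟨_, h1 a.1 a.2⟩ * (y ⟨_, h2 a.1 a.2⟩)⁻¹ * (y ⟨_, h3 a.1 a.2⟩)⁻¹))) V) := by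
  -- the degree-one lifts of the per-link spline kernels and their derivatives
  set Φ : {e // p e} → ({f : Edge d L // ¬p f} → Circle) → ℝ → ℝ := fun a y t =>
    2 * π * (g a.1 y (Int.fract ((t + c a.1 y) / (2 * π))) +
      ((⌊(t + c a.1 y) / (2 * π)⌋ : ℤ) : ℝ)) + c' a.1 y with hΦ
  set Φ' : {e // p e} → ({f : Edge d L // ¬p f} → Circle) → ℝ → ℝ := fun a y θ =>
    g' a.1 y (Int.fract ((θ + c a.1 y) / (2 * π))) with hΦ'
  have hmem : ∀ (a : {e // p e}) y, ∀ u ∈ Icc (0 : ℝ) 1, u ∈ Icc (X a.1 y 0) (X a.1 y K) :=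
    fun a y u hu => by rwa [hX0, hXK]
  have hderiv01 : ∀ (a : {e // p e}) y, ∀ u ∈ Icc (0 : ℝ) 1,
      HasDerivWithinAt (g a.1 y) (g' a.1 y u) (Icc 0 1) u := fun a y u hu => by
    have h0 := circRQS_hasDerivWithinAt (hw a.1 y) (hh a.1 y) (hd a.1 y) (hXs a.1 y) (hg a.1 y)
      (hg' a.1 y) (hmem a y u hu)
    rwa [hX0, hXK] at h0
  have hpos01 : ∀ (a : {e // p e}) y, ∀ u ∈ Icc (0 : ℝ) 1, 0 < g' a.1 y u := fun a y u hu =>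
    circRQS_deriv_pos hK (hw a.1 y) (hh a.1 y) (hd a.1 y) (hXs a.1 y) (hg' a.1 y) (hmem a y u hu)
  have hdeg01 : ∀ (a : {e // p e}) y, g a.1 y 1 = g a.1 y 0 + 1 := fun a y => by
    have h1' := circRQS_apply_right hK (hw a.1 y) (hh a.1 y) (hXs a.1 y) (hYs a.1 y) (hg a.1 y)
    have h0' := circRQS_apply_left hK (hw a.1 y) (hXs a.1 y) (hg a.1 y)
    rw [hXK, hYK] at h1'
    rw [hX0, hY0] at h0'
    rw [h1', h0', zero_add]
  have hslope01 : ∀ (a : {e // p e}) y, g' a.1 y 1 = g' a.1 y 0 := fun a y => by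
    have h1' := circRQS_deriv_right hK (hw a.1 y) (hh a.1 y) (hXs a.1 y) (hg' a.1 y)
    have h0' := circRQS_deriv_left hK (hw a.1 y) (hh a.1 y) (hXs a.1 y) (hg' a.1 y)
    rw [hXK] at h1'
    rw [hX0] at h0'
    rw [h1', h0', hcirc]
  have hderiv : ∀ a y θ, HasDerivAt (Φ a y) (Φ' a y θ) θ := fun a y θ =>
    hasDerivAt_circSplineLift (hderiv01 a y) (hdeg01 a y) (hslope01 a y) (c a.1 y) (c' a.1 y) θ
  have hpos : ∀ a y θ, 0 < Φ' a y θ := fun a y θ => unitExt_deriv_pos (hpos01 a y) _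
  have hdeg : ∀ a y θ, Φ a y (θ + 2 * π) = Φ a y θ + 2 * π := fun a y θ =>
    circSplineLift_add_two_pi (g a.1 y) (c a.1 y) (c' a.1 y) θ
  have hinner : ∀ a : {e // p e}, Measurable fun w : ℝ × ({f : Edge d L // ¬p f} → Circle) =>
      (w.1 + c a.1 w.2) / (2 * π) := fun a =>
    (measurable_fst.add ((hc a.1).comp measurable_snd)).div_const _
  have hΦm : ∀ a, Measurable fun w : ℝ × ({f : Edge d L // ¬p f} → Circle) => Φ a w.2 w.1 := by
    intro a
    refine ((measurable_const.mul (((hgm a.1).comp (measurable_snd.prodMk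
      (measurable_fract.comp (hinner a)))).add ?_)).add ((hc' a.1).comp measurable_snd))
    exact (measurable_of_countable (fun z : ℤ => (z : ℝ))).comp (Int.measurable_floor.comp (hinner a))
  -- single-link measurable equivalences realising the kernels
  obtain ⟨φe, hφe, hφem, hφesm⟩ := exists_coupleEquiv_of_hasDerivAt_pos (p := p) hderiv hpos hdeg hΦm
  have hHφ : ∀ (a : {e // p e}) y (u : Circle), H a.1 y u = φe a y u := by
    intro a y u
    obtain ⟨θ, rfl⟩ := Circle.exp_surjective u
    rw [hH, hφe]
    exact Circle.exp_eq_exp.mpr ⟨-⌊(θ + c a.1 y) / (2 * π)⌋, by simp only [hΦ]; push_cast; ring⟩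
  -- the staple and the loop
  have hev : ∀ f₀ : {f : Edge d L // ¬p f}, Measurable fun y : ({f : Edge d L // ¬p f} → Circle) => y f₀ :=
    fun f₀ => measurable_pi_apply f₀
  have hS : ∀ a : {e // p e}, Measurable fun y : ({f : Edge d L // ¬p f} → Circle) =>
      y ⟨_, h1 a.1 a.2⟩ * (y ⟨_, h2 a.1 a.2⟩)⁻¹ * (y ⟨_, h3 a.1 a.2⟩)⁻¹ := fun a =>
    ((hev _).mul (hev _).inv).mul (hev _).inv
  have hloop : ∀ a : {e // p e}, Measurable fun q : Circle × ({f : Edge d L // ¬p f} → Circle) =>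
      q.1 * (q.2 ⟨_, h1 a.1 a.2⟩ * (q.2 ⟨_, h2 a.1 a.2⟩)⁻¹ * (q.2 ⟨_, h3 a.1 a.2⟩)⁻¹) := fun a =>
    measurable_fst.mul ((hS a).comp measurable_snd)
  -- conjugating by the (frozen) staple translation: `u ↦ φ(uS) S⁻¹`
  set ψ : {e // p e} → ({f : Edge d L // ¬p f} → Circle) → Circle ≃ᵐ Circle := fun a y =>
    { toFun := fun u => φe a y (u * (y ⟨_, h1 a.1 a.2⟩ * (y ⟨_, h2 a.1 a.2⟩)⁻¹ * (y ⟨_, h3 a.1 a.2⟩)⁻¹)) *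
        (y ⟨_, h1 a.1 a.2⟩ * (y ⟨_, h2 a.1 a.2⟩)⁻¹ * (y ⟨_, h3 a.1 a.2⟩)⁻¹)⁻¹
      invFun := fun v => (φe a y).symm (v * (y ⟨_, h1 a.1 a.2⟩ * (y ⟨_, h2 a.1 a.2⟩)⁻¹ * (y ⟨_, h3 a.1 a.2⟩)⁻¹)) *
        (y ⟨_, h1 a.1 a.2⟩ * (y ⟨_, h2 a.1 a.2⟩)⁻¹ * (y ⟨_, h3 a.1 a.2⟩)⁻¹)⁻¹
      left_inv := fun u => by
        simp only [inv_mul_cancel_right, MeasurableEquiv.symm_apply_apply, mul_inv_cancel_right]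
      right_inv := fun v => by
        simp only [inv_mul_cancel_right, MeasurableEquiv.apply_symm_apply, mul_inv_cancel_right]
      measurable_toFun := ((φe a y).measurable.comp (measurable_id.mul_const _)).mul_const _
      measurable_invFun := ((φe a y).symm.measurable.comp (measurable_id.mul_const _)).mul_const _ }
    with hψdef
  have hψm : ∀ a, Measurable fun q : Circle × ({f : Edge d L // ¬p f} → Circle) => ψ a q.2 q.1 := fun a =>
    ((hφem a).comp ((hloop a).prodMk measurable_snd)).mul ((hS a).comp measurable_snd).inv
  have hψsm : ∀ a, Measurable fun q : Circle × ({f : Edge d L // ¬p f} → Circle) => (ψ a q.2).symm q.1 :=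
    fun a => ((hφesm a).comp ((hloop a).prodMk measurable_snd)).mul ((hS a).comp measurable_snd).inv
  -- the layer is `coupleFun p ψ`
  have hbridge := plaquetteKernelLayer_eq_coupleFun p ν hol H hHV h1 h2 h3
  have hψeq : (fun (a : {e // p e}) (y : {f : Edge d L // ¬p f} → Circle) (u : Circle) =>
      H a.1 y (u * (y ⟨_, h1 a.1 a.2⟩ * (y ⟨_, h2 a.1 a.2⟩)⁻¹ * (y ⟨_, h3 a.1 a.2⟩)⁻¹)) *
        (u * (y ⟨_, h1 a.1 a.2⟩ * (y ⟨_, h2 a.1 a.2⟩)⁻¹ * (y ⟨_, h3 a.1 a.2⟩)⁻¹))⁻¹ * u) =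
      fun a y u => ψ a y u := by
    funext a y u
    rw [hHφ, mul_assoc, mul_inv_rev, inv_mul_cancel_right]
    rfl
  refine ⟨coupleEquiv ψ hψm hψsm, ?_, ?_⟩
  · rw [coe_coupleEquiv, hbridge, hψeq]
  · rw [coe_coupleEquiv, ← hψeq, ← hbridge]
    exact hasJacobian_u1SplinePlaquetteCouplingLayer p ν h1 h2 h3 hK hw hh hd hcirc hX0 hXs hXK hY0 hYs
      hYK hc hc' hgm hg'm hg hg' hol H hHV hH j hj

end Equiv

end Summit.Ventures.LatticeQCDFlow.Exactness
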